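import Summits.QuantumFields.YangMills.Theorems.FlatTubeReductionOrthoDensity
import Summits.QuantumFields.YangMills.Theorems.FemtoTransferGapRungW1up
import HarnessLib

/-!
# (B-ST) atom (B3) «PiDensity», SHARP form: the transverse measure `π = orthoTransverse L` has Lebesgue density CONTINUOUS AT THE VACUUM —
# `(1−ε)·ρ₀·balLebesgue L A ≤ π(A) ≤ (1+ε)·ρ₀·balLebesgue L A` for measurable `A ⊆ capBalancedSet L ∩ ball 0 r(ε)`, `ρ₀ = |det D(orthoFlat L)(0)|·(2π²)^{3−|E|}`
# (lane A of S-BASE, crux `TwistedTraceScaling` stmt-QuantumFields-20203, C4-CORE, the (B-ST) pen, hand B; `pub/ym-fleet/ym-luscher-20007-p1/HANDOFF-g21.md` §REMAINING ANALYTIC ATOMS (B3),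
# hand A's PROGRESS 9/10: the atom (A) needs `ρ_π(y)/ρ_π(0) → 1` on shrinking balls, not only two-sided constants)

The CONSTANT-grade comparison `c·ν ≤ π ≤ C·ν` near `0` (`ν = balLebesgue L`, Lebesgue measure of the balanced subspace in the off-base coordinates) is the tree's
★★★ `…FlatTubeReductionOrthoDensity.orthoTransverse_two_sided` (route FlatTubeReduction, seat ym-line-ftr-p1 g16): product formula `σ³(window_r)·π(A) = σ^{⊗E}(tube set)`, tube set =
gnomonic image of `orthoFlat L '' flatBox`, product gnomonic chart law, `vol(orthoFlat '' S) ≍ |det|·vol S` by approximate linearity (Mathlib `addHaar_image_le_mul_of_det_lt` /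
`mul_le_addHaar_image_of_lt_det`), `vol(flatBox) = vol(ball_r)·ν(A)`.  THIS FILE runs the same machine with every slack sent to zero:
* §1 the slow window of gnomonic radius `r` IS the gnomonic image of the sup-ball (`slowWindow_eq_image_ball`), so by the ONE-SITE chart law its measure is two-sidedly
  `(2π²)^{-3}(1+3r²)^{-6}·vol(ball_r) ≤ σ³(window_r) ≤ (2π²)^{-3}·vol(ball_r)` (`configMeasure_slowWindow_two_sided`), and `vol(ball_r)` is the same number `(2r)⁹` for the base block of
  the flat box (`volume_ball_oneSite_eq`);
* §2 the flat image of the sup-ball of radius `r ≤ 1/(4N)` lies in the sup-box of side `(N+1+10N²)·r` (`abs_orthoFlat_le_linear`), where the gnomonic density is `≥ (2π²)^{-|E|}(1+3s²)^{-2|E|}`;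
* §3 ★★★ `orthoTransverse_sharp` — for every `ε > 0` a radius `r > 0` with `(1−ε)ρ₀·ν(A) ≤ π(A) ≤ (1+ε)ρ₀·ν(A)` on measurable `A ⊆ capBalancedSet L ∩ ball 0 r`
  (`ρ₀ = piDensityZero L`, an `L`-dependent, `β`-free positive constant); ★★ `orthoTransverse_sharp_linkEmbed` (Euclidean radius); ★★★ `orthoTransverse_lintegral_sharp`
  (`(1−ε)ρ₀∫f dν ≤ ∫f dπ ≤ (1+ε)ρ₀∫f dν` for measurable `f ≥ 0` vanishing off the ball).
HONEST FRAMING: chart-density bookkeeping (Mathlib calculus/measure theory + the tree's gnomonic Haar formula) for a stub of a child of the CONDITIONAL route R2b1; (B-ST) OPEN; C4-CORE OPEN;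
not infinite volume, not a gap, not Clay.  No named facts, no `sorry`.
-/

set_option autoImplicit false

noncomputable section

open MeasureTheory Filter Topology Real
open scoped BigOperators Matrix NNReal ENNReal
open Literature.MathematicalPhysics.QuantumFieldTheory
open Literature.MathematicalPhysics.QuantumLattice
open Literature.MathematicalPhysics.QuantumFieldTheory.Balaban1983to89.T4CubeChartGnomonic (gnoPoint gnoPoint_injective gnoWeight gnoWeight_le gnoWeight_ge_of_mem_cube)

namespace Summit.QuantumFields.YangMills.Theorems.FemtoTransferGap.TwoLattice.ConstTube

open Summit.QuantumFields.YangMills.Theorems.FemtoTransferGap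
open Summit.QuantumFields.YangMills.Theorems.FemtoTransferGap.TwoLattice.SlowChart
open Summit.QuantumFields.YangMills.Theorems.FemtoTransferGap.TwoLattice.GnChart
open Literature.MathematicalPhysics.QuantumFieldTheory.Balaban1983to89.T4CubePoincare (cube mem_cube_iff)
open Summit.QuantumFields.YangMills.Theorems.FemtoTransferGap.TwoLattice.Cov (scalarPart_inv vecPart_inv)

variable (L : ℕ) [NeZero L]

/-! ## §1 The slow window is the gnomonic image of the sup-ball; its one-site measure two-sidedly -/

omit [NeZero L] in
/-- **The slow window of gnomonic radius `r` is the gnomonic image of the sup-ball of radius `r`** in the one-site coordinates `Edge 3 1 → ℝ³`. [folklore] -/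
theorem slowWindow_eq_image_ball (r : ℝ) :
    {u : GaugeConfig 3 1 SU2 | ∀ e₁ : Edge 3 1, 0 < scalarPart (u e₁) ∧ ‖vecPart (u e₁)‖ < r * scalarPart (u e₁)} =
      (fun z : Edge 3 1 → Fin 3 → ℝ => fun e => gnoPoint (z e)) '' Metric.ball (0 : Edge 3 1 → Fin 3 → ℝ) r := by
  ext u
  simp only [Set.mem_setOf_eq, Set.mem_image]
  constructor
  · intro hu
    have hr : 0 < r := by
      obtain ⟨hs, hv⟩ := hu ((0 : Site 3 1), 0)
      rcases le_or_gt r 0 with h | h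
      · have : r * scalarPart (u (0, 0)) ≤ 0 := mul_nonpos_of_nonpos_of_nonneg h hs.le
        linarith [norm_nonneg (vecPart (u (0, 0)))]
      · exact h
    refine ⟨fun e₁ => gnLink (u e₁), ?_, funext fun e₁ => gnoPoint_gnLink _ (hu e₁).1⟩
    rw [mem_ball_zero_iff, pi_norm_lt_iff hr]
    intro e₁
    obtain ⟨hs, hv⟩ := hu e₁
    have hgl : gnLink (u e₁) = (scalarPart (u e₁))⁻¹ • vecPart (u e₁) := by
      funext a; rw [gnLink_apply, Pi.smul_apply, smul_eq_mul, div_eq_inv_mul]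
    rw [hgl, norm_smul, norm_inv, Real.norm_eq_abs, abs_of_pos hs, inv_mul_lt_iff₀ hs]
    linarith [mul_comm r (scalarPart (u e₁))]
  · rintro ⟨z, hz, rfl⟩ e₁
    refine ⟨scalarPart_gnoPoint_pos _, ?_⟩
    have hr : 0 < r := (norm_nonneg _).trans_lt (mem_ball_zero_iff.1 hz)
    rw [vecPart_gnoPoint_eq_smul, norm_smul, Real.norm_eq_abs, abs_of_pos (scalarPart_gnoPoint_pos _), mul_comm]
    exact mul_lt_mul_of_pos_right ((pi_norm_lt_iff hr).1 (mem_ball_zero_iff.1 hz) e₁) (scalarPart_gnoPoint_pos _)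

omit [NeZero L] in
/-- The one-site gnomonic density on the sup-ball of radius `r`: `(2π²)^{-3}(1+3r²)^{-6} ≤ Π_{e₁} w(z_{e₁}) ≤ (2π²)^{-3}`. [folklore] -/
theorem piGnDensity_oneSite_bounds {r : ℝ} {z : Edge 3 1 → Fin 3 → ℝ} (hz : z ∈ Metric.ball (0 : Edge 3 1 → Fin 3 → ℝ) r) :
    ENNReal.ofReal (((2 * π ^ 2)⁻¹ * ((1 + 3 * r ^ 2)⁻¹) ^ 2) ^ Fintype.card (Edge 3 1)) ≤ piGnDensity (Edge 3 1) z ∧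
      piGnDensity (Edge 3 1) z ≤ ENNReal.ofReal (((2 * π ^ 2)⁻¹) ^ Fintype.card (Edge 3 1)) := by
  have hr : 0 < r := (norm_nonneg _).trans_lt (mem_ball_zero_iff.1 hz)
  constructor
  · rw [piGnDensity_eq, piGnDensityReal, ← Finset.card_univ, ← Finset.prod_const]
    refine ENNReal.ofReal_le_ofReal (Finset.prod_le_prod (fun e _ => by positivity) fun e _ => ?_)
    refine gnoWeight_ge_of_mem_cube (S := r) ((mem_cube_iff).2 fun a => ?_)
    have h := (pi_norm_lt_iff hr).1 (mem_ball_zero_iff.1 hz) e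
    exact ((Real.norm_eq_abs _).symm.le.trans (norm_le_pi_norm (z e) a)).trans h.le
  · rw [piGnDensity_eq]; exact ENNReal.ofReal_le_ofReal (piGnDensityReal_pos_le (Edge 3 1) z).2

omit [NeZero L] in
/-- ★ **The one-site measure of the slow window, two-sidedly**: `(2π²)^{-3}(1+3r²)^{-6}·vol(ball_r) ≤ σ³(window_r) ≤ (2π²)^{-3}·vol(ball_r)` (the ONE-SITE gnomonic chart law
`…OrthoDensityProduct.configMeasure_image_gnoPoint` at `L = 1`). [folklore] -/
theorem configMeasure_slowWindow_two_sided (r : ℝ) :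
    ENNReal.ofReal (((2 * π ^ 2)⁻¹ * ((1 + 3 * r ^ 2)⁻¹) ^ 2) ^ Fintype.card (Edge 3 1)) * volume (Metric.ball (0 : Edge 3 1 → Fin 3 → ℝ) r) ≤
        configMeasure SU2 1 {u : GaugeConfig 3 1 SU2 | ∀ e₁ : Edge 3 1, 0 < scalarPart (u e₁) ∧ ‖vecPart (u e₁)‖ < r * scalarPart (u e₁)} ∧
      configMeasure SU2 1 {u : GaugeConfig 3 1 SU2 | ∀ e₁ : Edge 3 1, 0 < scalarPart (u e₁) ∧ ‖vecPart (u e₁)‖ < r * scalarPart (u e₁)} ≤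
        ENNReal.ofReal (((2 * π ^ 2)⁻¹) ^ Fintype.card (Edge 3 1)) * volume (Metric.ball (0 : Edge 3 1 → Fin 3 → ℝ) r) := by
  have hm : MeasurableSet ((fun z : Edge 3 1 → Fin 3 → ℝ => fun e => gnoPoint (z e)) '' Metric.ball (0 : Edge 3 1 → Fin 3 → ℝ) r) := by
    rw [← slowWindow_eq_image_ball]; exact (isOpen_slowWindow r).measurableSet
  rw [slowWindow_eq_image_ball, configMeasure_image_gnoPoint 1 hm, withDensity_apply _ Metric.isOpen_ball.measurableSet]
  constructor
  · calc ENNReal.ofReal (((2 * π ^ 2)⁻¹ * ((1 + 3 * r ^ 2)⁻¹) ^ 2) ^ Fintype.card (Edge 3 1)) * volume (Metric.ball (0 : Edge 3 1 → Fin 3 → ℝ) r)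
        = ∫⁻ _z in Metric.ball (0 : Edge 3 1 → Fin 3 → ℝ) r, ENNReal.ofReal (((2 * π ^ 2)⁻¹ * ((1 + 3 * r ^ 2)⁻¹) ^ 2) ^ Fintype.card (Edge 3 1)) :=
          (setLIntegral_const _ _).symm
      _ ≤ ∫⁻ z in Metric.ball (0 : Edge 3 1 → Fin 3 → ℝ) r, piGnDensity (Edge 3 1) z :=
          setLIntegral_mono (measurable_piGnDensity (Edge 3 1)) fun z hz => (piGnDensity_oneSite_bounds hz).1
  · calc ∫⁻ z in Metric.ball (0 : Edge 3 1 → Fin 3 → ℝ) r, piGnDensity (Edge 3 1) z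
        ≤ ∫⁻ _z in Metric.ball (0 : Edge 3 1 → Fin 3 → ℝ) r, ENNReal.ofReal (((2 * π ^ 2)⁻¹) ^ Fintype.card (Edge 3 1)) :=
          setLIntegral_mono measurable_const fun z hz => (piGnDensity_oneSite_bounds hz).2
      _ = ENNReal.ofReal (((2 * π ^ 2)⁻¹) ^ Fintype.card (Edge 3 1)) * volume (Metric.ball (0 : Edge 3 1 → Fin 3 → ℝ) r) := setLIntegral_const _ _

/-- The sup-ball of radius `r > 0` in the one-site coordinates and in the base block of the flat box have the same volume `(2r)⁹`. [folklore] -/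
theorem volume_ball_oneSite_eq {r : ℝ} (hr : 0 < r) :
    volume (Metric.ball (0 : Edge 3 1 → Fin 3 → ℝ) r) = volume (Metric.ball (0 : {e : Edge 3 L // e.1 = 0} → Fin 3 → ℝ) r) := by
  have h1 : Fintype.card (Edge 3 1) = 3 := card_edge_one
  have h2 : Fintype.card {e : Edge 3 L // e.1 = 0} = 3 := by
    rw [Fintype.card_subtype]
    have : (Finset.univ.filter fun e : Edge 3 L => e.1 = 0) = Finset.univ.image fun k : Fin 3 => ((0 : Site 3 L), k) := by
      ext ⟨x, k⟩
      simp only [Finset.mem_filter, Finset.mem_univ, true_and, Finset.mem_image, Prod.mk.injEq]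
      constructor
      · rintro rfl; exact ⟨k, rfl, rfl⟩
      · rintro ⟨k', hx, rfl⟩; exact hx.symm
    rw [this, Finset.card_image_of_injective _ (fun a b h => by simpa using h), Finset.card_univ, Fintype.card_fin]
  rw [MeasureTheory.volume_pi_ball _ hr, MeasureTheory.volume_pi_ball _ hr]
  simp only [Pi.zero_apply, Finset.prod_const, Finset.card_univ, h1, h2]


/-! ## §2 The flat image of a small sup-ball lies in a proportionally small sup-box, where the gnomonic density is almost its vacuum value -/

/-- ★ For `‖y‖ ≤ 1/(4N)`: `|orthoFlat L y e a| ≤ (N + 1 + 10N²)·‖y‖` (linear part `≤ (N+1)‖y‖`, quadratic remainder `≤ 10N²‖y‖² ≤ 10N²‖y‖`). [folklore] -/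
theorem abs_orthoFlat_le_linear {y : Edge 3 L → Fin 3 → ℝ} (hy : ‖y‖ ≤ 1 / (4 * Fintype.card (Site 3 L))) (e : Edge 3 L) (a : Fin 3) :
    |orthoFlat L y e a| ≤ (Fintype.card (Site 3 L) + 1 + 10 * (Fintype.card (Site 3 L) : ℝ) ^ 2) * ‖y‖ := by
  set N : ℝ := (Fintype.card (Site 3 L) : ℝ) with hN
  have hN1 : (1 : ℝ) ≤ N := by rw [hN]; exact_mod_cast Fintype.card_pos
  have hy0 : 0 ≤ ‖y‖ := norm_nonneg _
  have hy1 : ‖y‖ ≤ 1 := hy.trans (by rw [div_le_one (by positivity)]; linarith)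
  have h1 := abs_orthoFlat_sub_lin_le L hy e a
  have h2 : |orthoFlatLin L y e a| ≤ (N + 1) * ‖y‖ := by
    rw [orthoFlatLin_apply]
    calc |balFill L y e a + y (0, e.2) a| ≤ |balFill L y e a| + |y (0, e.2) a| := abs_add_le _ _
      _ ≤ N * ‖y‖ + ‖y‖ := add_le_add (abs_balFill_le L y e a) (abs_apply_le_norm L y _ a)
      _ = (N + 1) * ‖y‖ := by ring
  have h3 : |orthoFlat L y e a| ≤ |orthoFlatLin L y e a| + |orthoFlat L y e a - orthoFlatLin L y e a| := by
    have := abs_add_le (orthoFlatLin L y e a) (orthoFlat L y e a - orthoFlatLin L y e a)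
    rwa [add_sub_cancel] at this
  have h4 : ‖y‖ ^ 2 ≤ ‖y‖ := by nlinarith
  calc |orthoFlat L y e a| ≤ (N + 1) * ‖y‖ + 10 * N ^ 2 * ‖y‖ ^ 2 := h3.trans (add_le_add h2 h1)
    _ ≤ (N + 1) * ‖y‖ + 10 * N ^ 2 * ‖y‖ := by gcongr
    _ = (N + 1 + 10 * N ^ 2) * ‖y‖ := by ring

/-- The flat image of the flat box over `A ⊆ ball 0 r` (`r ≤ 1/(4N)`) lies in the sup-box of side `(N+1+10N²)·r`. [folklore] -/
theorem orthoFlat_image_flatBox_subset_box {r : ℝ} (hr0 : 0 < r) (hr : r ≤ 1 / (4 * Fintype.card (Site 3 L))) {A : Set (Edge 3 L → Fin 3 → ℝ)}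
    (hAb : A ⊆ Metric.ball 0 r) :
    orthoFlat L '' {y : Edge 3 L → Fin 3 → ℝ | (fun i : {e : Edge 3 L // e.1 = 0} => y i.1) ∈ Metric.ball (0 : {e : Edge 3 L // e.1 = 0} → Fin 3 → ℝ) r ∧ balFill L y ∈ A} ⊆
      {z | ∀ (e : Edge 3 L) (a : Fin 3), |z e a| ≤ (Fintype.card (Site 3 L) + 1 + 10 * (Fintype.card (Site 3 L) : ℝ) ^ 2) * r} := by
  rintro _ ⟨y, hy, rfl⟩ e a
  have hyr : ‖y‖ < r := mem_ball_zero_iff.1 (flatBox_subset_ball L hr0 le_rfl hAb hy)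
  calc |orthoFlat L y e a| ≤ (Fintype.card (Site 3 L) + 1 + 10 * (Fintype.card (Site 3 L) : ℝ) ^ 2) * ‖y‖ := abs_orthoFlat_le_linear L (hyr.le.trans hr) e a
    _ ≤ (Fintype.card (Site 3 L) + 1 + 10 * (Fintype.card (Site 3 L) : ℝ) ^ 2) * r := mul_le_mul_of_nonneg_left hyr.le (by positivity)

/-- ★ **The gnomonic chart law vs Lebesgue on the sup-box of side `s`** (any set `W` inside it):
`((2π²)⁻¹(1+3s²)⁻²)^{|E|}·vol W ≤ (vol.withDensity Π_e w)(W) ≤ (2π²)^{-|E|}·vol W`. [folklore] -/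
theorem withDensity_piGnDensity_two_sided_of_box (s : ℝ) {W : Set (Edge 3 L → Fin 3 → ℝ)} (hW : W ⊆ {z | ∀ (e : Edge 3 L) (a : Fin 3), |z e a| ≤ s}) :
    ENNReal.ofReal (((2 * π ^ 2)⁻¹ * ((1 + 3 * s ^ 2)⁻¹) ^ 2) ^ Fintype.card (Edge 3 L)) * volume W ≤
        ((volume : Measure (Edge 3 L → Fin 3 → ℝ)).withDensity (piGnDensity (Edge 3 L))) W ∧
      ((volume : Measure (Edge 3 L → Fin 3 → ℝ)).withDensity (piGnDensity (Edge 3 L))) W ≤ ENNReal.ofReal (((2 * π ^ 2)⁻¹) ^ Fintype.card (Edge 3 L)) * volume W := by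
  have hK : MeasurableSet {z : Edge 3 L → Fin 3 → ℝ | ∀ (e : Edge 3 L) (a : Fin 3), |z e a| ≤ s} := by
    have h : {z : Edge 3 L → Fin 3 → ℝ | ∀ (e : Edge 3 L) (a : Fin 3), |z e a| ≤ s} = ⋂ e : Edge 3 L, ⋂ a : Fin 3, {z | |z e a| ≤ s} := by ext z; simp
    rw [h]
    exact MeasurableSet.iInter fun e => MeasurableSet.iInter fun a =>
      measurableSet_le (continuous_abs.measurable.comp ((measurable_pi_apply a).comp (measurable_pi_apply e))) measurable_const
  have hlow : ∀ z ∈ {z : Edge 3 L → Fin 3 → ℝ | ∀ (e : Edge 3 L) (a : Fin 3), |z e a| ≤ s},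
      ENNReal.ofReal (((2 * π ^ 2)⁻¹ * ((1 + 3 * s ^ 2)⁻¹) ^ 2) ^ Fintype.card (Edge 3 L)) ≤ piGnDensity (Edge 3 L) z := fun z hz => by
    rw [piGnDensity_eq, piGnDensityReal, ← Finset.card_univ, ← Finset.prod_const]
    refine ENNReal.ofReal_le_ofReal (Finset.prod_le_prod (fun e _ => by positivity) fun e _ => ?_)
    exact gnoWeight_ge_of_mem_cube (S := s) ((mem_cube_iff).2 fun a => hz e a)
  rw [withDensity_apply' _ W]
  constructor
  · set c : ℝ≥0∞ := ENNReal.ofReal (((2 * π ^ 2)⁻¹ * ((1 + 3 * s ^ 2)⁻¹) ^ 2) ^ Fintype.card (Edge 3 L))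
    have hle : ∀ z, ({z : Edge 3 L → Fin 3 → ℝ | ∀ (e : Edge 3 L) (a : Fin 3), |z e a| ≤ s}.indicator (fun _ => c) z) ≤ piGnDensity (Edge 3 L) z := fun z => by
      by_cases hz : z ∈ {z : Edge 3 L → Fin 3 → ℝ | ∀ (e : Edge 3 L) (a : Fin 3), |z e a| ≤ s}
      · rw [Set.indicator_of_mem hz]; exact hlow z hz
      · rw [Set.indicator_of_notMem hz]; exact bot_le
    calc c * volume W = c * (volume.restrict W) {z : Edge 3 L → Fin 3 → ℝ | ∀ (e : Edge 3 L) (a : Fin 3), |z e a| ≤ s} := by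
          rw [Measure.restrict_apply hK, Set.inter_eq_right.2 hW]
      _ = ∫⁻ z in W, {z : Edge 3 L → Fin 3 → ℝ | ∀ (e : Edge 3 L) (a : Fin 3), |z e a| ≤ s}.indicator (fun _ => c) z := by
          rw [lintegral_indicator hK, setLIntegral_const]
      _ ≤ ∫⁻ z in W, piGnDensity (Edge 3 L) z := lintegral_mono hle
  · calc ∫⁻ z in W, piGnDensity (Edge 3 L) z ≤ ∫⁻ _z in W, ENNReal.ofReal (((2 * π ^ 2)⁻¹) ^ Fintype.card (Edge 3 L)) :=
          lintegral_mono fun z => (piGnDensity_bounds L z).1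
      _ = ENNReal.ofReal (((2 * π ^ 2)⁻¹) ^ Fintype.card (Edge 3 L)) * volume W := setLIntegral_const _ _

/-! ## §3 ★★★ The SHARP two-sided density: `π = (1 ± ε)·ρ₀·ν` on shrinking balls -/

/-- ★★★ **(B3) SHARP «PiDensity» — THE LEBESGUE DENSITY OF `π = orthoTransverse L` IS CONTINUOUS AT THE VACUUM.**  There is an `L`-dependent constant `ρ₀ > 0`
(`= |det D(orthoFlat L)(0)|·(2π²)^{3−|E|}`) such that for every `ε > 0` there is `r > 0` with
`(1−ε)·ρ₀·balLebesgue L A ≤ orthoTransverse L A ≤ (1+ε)·ρ₀·balLebesgue L A` for every measurable `A ⊆ capBalancedSet L ∩ ball 0 r` (sup-ball).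
Assembly as in `orthoTransverse_two_sided`, with volume-distortion factors `|det|(1 ± ε₁)`, the slow window of the SAME radius `r` (its one-site measure is
`(2π²)^{-3}(1+3r²)^{∓6}·vol(ball_r)`, `configMeasure_slowWindow_two_sided`), and the gnomonic density on the image box of side `(N+1+10N²)r`. [cite: Luscher1983, §3] -/
theorem orthoTransverse_sharp :
    ∃ ρ₀ : ℝ, 0 < ρ₀ ∧ ∀ ε : ℝ, 0 < ε → ∃ r : ℝ, 0 < r ∧ ∀ A : Set (Edge 3 L → Fin 3 → ℝ), MeasurableSet A → A ⊆ capBalancedSet L → A ⊆ Metric.ball 0 r →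
      ENNReal.ofReal ((1 - ε) * ρ₀) * balLebesgue L A ≤ orthoTransverse L A ∧ orthoTransverse L A ≤ ENNReal.ofReal ((1 + ε) * ρ₀) * balLebesgue L A := by
  have hN : (0 : ℝ) < Fintype.card (Site 3 L) := by exact_mod_cast Fintype.card_pos
  -- the constants
  set q : ℝ := (2 * π ^ 2)⁻¹ with hq
  have hq0 : 0 < q := by rw [hq]; positivity
  set E : ℕ := Fintype.card (Edge 3 L) with hE
  set E₁ : ℕ := Fintype.card (Edge 3 1) with hE₁
  set d : ℝ := |(orthoFlatLin L).det| with hd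
  have hd0 : 0 < d := abs_pos.2 (orthoFlatLin_det_ne_zero L)
  set M : ℝ := Fintype.card (Site 3 L) + 1 + 10 * (Fintype.card (Site 3 L) : ℝ) ^ 2 with hM
  set ρ₀ : ℝ := d * q ^ E / q ^ E₁ with hρ₀
  have hρ₀0 : 0 < ρ₀ := by rw [hρ₀]; positivity
  refine ⟨ρ₀, hρ₀0, fun ε hε => ?_⟩
  -- the volume-distortion slack
  set ε₁ : ℝ := min (ε / 2) (1 / 2) with hε₁
  have hε₁0 : 0 < ε₁ := lt_min (by linarith) (by norm_num)
  have hε₁ε : ε₁ < ε := (min_le_left _ _).trans_lt (by linarith)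
  have hε₁1 : ε₁ ≤ 1 / 2 := min_le_right _ _
  have hup : ENNReal.ofReal |(orthoFlatLin L).det| < ((Real.toNNReal (d * (1 + ε₁)) : ℝ≥0) : ℝ≥0∞) := by
    rw [← hd, ← ENNReal.ofReal]
    exact (ENNReal.ofReal_lt_ofReal_iff (by positivity)).2 (by nlinarith)
  have hlo : ((Real.toNNReal (d * (1 - ε₁)) : ℝ≥0) : ℝ≥0∞) < ENNReal.ofReal |(orthoFlatLin L).det| := by
    rw [← hd, ← ENNReal.ofReal]
    exact (ENNReal.ofReal_lt_ofReal_iff hd0).2 (by nlinarith)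
  have h1 := addHaar_image_le_mul_of_det_lt (volume : Measure (Edge 3 L → Fin 3 → ℝ)) (orthoFlatLin L) hup
  have h2 := mul_le_addHaar_image_of_lt_det (volume : Measure (Edge 3 L → Fin 3 → ℝ)) (orthoFlatLin L) hlo
  obtain ⟨δ, ⟨hP, hQ⟩, hδ0⟩ := ((h1.and h2).and self_mem_nhdsWithin).exists
  obtain ⟨ρ, hρ0, hAL⟩ := approximatesLinearOn_orthoFlat L (show (0 : ℝ≥0) < δ from hδ0)
  -- the radius: small enough for the chart regime, the approximate linearity, and the two density slacks
  have hcU : Continuous fun r : ℝ => (q * ((1 + 3 * r ^ 2)⁻¹) ^ 2) ^ E₁ * ((1 + ε) * ρ₀) :=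
    ((continuous_const.mul ((Continuous.inv₀ (by fun_prop) fun r => by positivity).pow 2)).pow E₁).mul continuous_const
  have hcL : Continuous fun r : ℝ => ((1 - ε) * ρ₀) * q ^ E₁ / (q * ((1 + 3 * (M * r) ^ 2)⁻¹) ^ 2) ^ E :=
    Continuous.div₀ continuous_const ((continuous_const.mul ((Continuous.inv₀ (by fun_prop) fun r => by positivity).pow 2)).pow E)
      fun r => by positivity
  have hU0 : q ^ E * (d * (1 + ε₁)) < (q * ((1 + 3 * (0 : ℝ) ^ 2)⁻¹) ^ 2) ^ E₁ * ((1 + ε) * ρ₀) := by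
    have h : (q * ((1 + 3 * (0 : ℝ) ^ 2)⁻¹) ^ 2) ^ E₁ * ((1 + ε) * ρ₀) = q ^ E * (d * (1 + ε)) := by
      rw [hρ₀]; field_simp; ring
    rw [h]
    exact mul_lt_mul_of_pos_left (mul_lt_mul_of_pos_left (by linarith) hd0) (by positivity)
  have hL0 : ((1 - ε) * ρ₀) * q ^ E₁ / (q * ((1 + 3 * (M * 0) ^ 2)⁻¹) ^ 2) ^ E < d * (1 - ε₁) := by
    have h : ((1 - ε) * ρ₀) * q ^ E₁ / (q * ((1 + 3 * (M * 0) ^ 2)⁻¹) ^ 2) ^ E = d * (1 - ε) := by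
      rw [hρ₀]; field_simp; ring
    rw [h]
    exact mul_lt_mul_of_pos_left (by linarith) hd0
  have hevU : ∀ᶠ r : ℝ in 𝓝 0, q ^ E * (d * (1 + ε₁)) < (q * ((1 + 3 * r ^ 2)⁻¹) ^ 2) ^ E₁ * ((1 + ε) * ρ₀) :=
    (continuous_const.continuousAt (x := (0 : ℝ))).eventually_lt hcU.continuousAt hU0
  have hevL : ∀ᶠ r : ℝ in 𝓝 0, ((1 - ε) * ρ₀) * q ^ E₁ / (q * ((1 + 3 * (M * r) ^ 2)⁻¹) ^ 2) ^ E < d * (1 - ε₁) :=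
    hcL.continuousAt.eventually_lt (continuous_const.continuousAt (x := (0 : ℝ))) hL0
  have hevρ : ∀ᶠ r : ℝ in 𝓝 0, r < ρ := eventually_lt_nhds hρ0
  have hevN : ∀ᶠ r : ℝ in 𝓝 0, r < 1 / (4 * Fintype.card (Site 3 L)) := eventually_lt_nhds (by positivity)
  have hev0 : ∀ᶠ r : ℝ in 𝓝[>] 0, 0 < r := self_mem_nhdsWithin
  obtain ⟨r, ⟨⟨⟨hrU, hrL⟩, hrρ⟩, hrN⟩, hr0⟩ :=
    (((((hevU.filter_mono nhdsWithin_le_nhds).and (hevL.filter_mono nhdsWithin_le_nhds)).and (hevρ.filter_mono nhdsWithin_le_nhds)).and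
      (hevN.filter_mono nhdsWithin_le_nhds)).and hev0).exists
  refine ⟨r, hr0, fun A hA hAc hAb => ?_⟩
  -- (3) the sets
  have hAbN : A ⊆ Metric.ball 0 (1 / (4 * Fintype.card (Site 3 L))) := hAb.trans (Metric.ball_subset_ball hrN.le)
  set S : Set (Edge 3 L → Fin 3 → ℝ) := {y | (fun i : {e : Edge 3 L // e.1 = 0} => y i.1) ∈ Metric.ball (0 : {e : Edge 3 L // e.1 = 0} → Fin 3 → ℝ) r ∧ balFill L y ∈ A} with hS
  have hSρ : S ⊆ Metric.ball 0 ρ := flatBox_subset_ball L hρ0 hrρ.le (hAb.trans (Metric.ball_subset_ball hrρ.le))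
  set vb : ℝ≥0∞ := volume (Metric.ball (0 : Edge 3 1 → Fin 3 → ℝ) r) with hvb
  have hvolS : volume S = vb * balLebesgue L A := by rw [hvb, volume_ball_oneSite_eq L hr0]; exact volume_flatBox L r hA
  -- (4) the Jacobian sandwich for `W = orthoFlat '' S`
  have hALS : ApproximatesLinearOn (orthoFlat L) (orthoFlatLin L) S δ := hAL.mono_set hSρ
  have hWup : volume (orthoFlat L '' S) ≤ ((Real.toNNReal (d * (1 + ε₁)) : ℝ≥0) : ℝ≥0∞) * volume S := hP S _ hALS
  have hWlo : ((Real.toNNReal (d * (1 - ε₁)) : ℝ≥0) : ℝ≥0∞) * volume S ≤ volume (orthoFlat L '' S) := hQ S _ hALS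
  -- (5) the chart law sandwich on the image box of side `M r`
  have hWbox := orthoFlat_image_flatBox_subset_box L hr0 hrN.le hAb
  obtain ⟨hDlo, hDhi⟩ := withDensity_piGnDensity_two_sided_of_box L (M * r) hWbox
  -- (6) the slow window two-sidedly, the product formula and the chart law
  obtain ⟨hwlo, hwhi⟩ := configMeasure_slowWindow_two_sided r
  set w : ℝ≥0∞ := configMeasure SU2 1 {u : GaugeConfig 3 1 SU2 | ∀ e₁ : Edge 3 1, 0 < scalarPart (u e₁) ∧ ‖vecPart (u e₁)‖ < r * scalarPart (u e₁)} with hw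
  have hw0 : w ≠ 0 := (configMeasure_slowWindow_pos hr0).ne'
  have hwtop : w ≠ ⊤ := (prob_le_one.trans_lt ENNReal.one_lt_top).ne
  have hT := slowEmb_image_eq L hr0 hrN.le hAc hAbN
  have hTm := measurableSet_slowEmb_image L r hA
  have hprod := configMeasure_slowWindow_mul_orthoTransverse L r hA
  rw [hT] at hTm hprod
  rw [configMeasure_image_gnoPoint L hTm] at hprod
  -- (7) assemble: compare `w · π(A)` with `w · (constant · ν A)` and cancel `w`
  constructor
  · refine (ENNReal.mul_le_mul_iff_right hw0 hwtop).1 ?_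
    rw [hprod]
    calc w * (ENNReal.ofReal ((1 - ε) * ρ₀) * balLebesgue L A) ≤ (ENNReal.ofReal (q ^ E₁) * vb) * (ENNReal.ofReal ((1 - ε) * ρ₀) * balLebesgue L A) := by gcongr
      _ = (ENNReal.ofReal (q ^ E₁) * ENNReal.ofReal ((1 - ε) * ρ₀)) * (vb * balLebesgue L A) := by ring
      _ ≤ (ENNReal.ofReal ((q * ((1 + 3 * (M * r) ^ 2)⁻¹) ^ 2) ^ E) * ((Real.toNNReal (d * (1 - ε₁)) : ℝ≥0) : ℝ≥0∞)) * (vb * balLebesgue L A) := by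
          gcongr ?_ * _
          rw [← ENNReal.ofReal_mul (by positivity), show (((Real.toNNReal (d * (1 - ε₁)) : ℝ≥0) : ℝ≥0∞)) = ENNReal.ofReal (d * (1 - ε₁)) from rfl,
            ← ENNReal.ofReal_mul (by positivity)]
          refine ENNReal.ofReal_le_ofReal ?_
          have hpos : 0 < (q * ((1 + 3 * (M * r) ^ 2)⁻¹) ^ 2) ^ E := by positivity
          have := (div_lt_iff₀ hpos).1 hrL
          linarith [mul_comm ((q * ((1 + 3 * (M * r) ^ 2)⁻¹) ^ 2) ^ E) (d * (1 - ε₁))]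
      _ = ENNReal.ofReal ((q * ((1 + 3 * (M * r) ^ 2)⁻¹) ^ 2) ^ E) * (((Real.toNNReal (d * (1 - ε₁)) : ℝ≥0) : ℝ≥0∞) * volume S) := by rw [hvolS]; ring
      _ ≤ ENNReal.ofReal ((q * ((1 + 3 * (M * r) ^ 2)⁻¹) ^ 2) ^ E) * volume (orthoFlat L '' S) := by gcongr
      _ ≤ ((volume : Measure (Edge 3 L → Fin 3 → ℝ)).withDensity (piGnDensity (Edge 3 L))) (orthoFlat L '' S) := hDlo
  · refine (ENNReal.mul_le_mul_iff_right hw0 hwtop).1 ?_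
    rw [hprod]
    calc ((volume : Measure (Edge 3 L → Fin 3 → ℝ)).withDensity (piGnDensity (Edge 3 L))) (orthoFlat L '' S)
        ≤ ENNReal.ofReal (q ^ E) * volume (orthoFlat L '' S) := hDhi
      _ ≤ ENNReal.ofReal (q ^ E) * (((Real.toNNReal (d * (1 + ε₁)) : ℝ≥0) : ℝ≥0∞) * volume S) := by gcongr
      _ = (ENNReal.ofReal (q ^ E) * ((Real.toNNReal (d * (1 + ε₁)) : ℝ≥0) : ℝ≥0∞)) * (vb * balLebesgue L A) := by rw [hvolS]; ring
      _ ≤ (ENNReal.ofReal ((q * ((1 + 3 * r ^ 2)⁻¹) ^ 2) ^ E₁) * ENNReal.ofReal ((1 + ε) * ρ₀)) * (vb * balLebesgue L A) := by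
          gcongr ?_ * _
          rw [show (((Real.toNNReal (d * (1 + ε₁)) : ℝ≥0) : ℝ≥0∞)) = ENNReal.ofReal (d * (1 + ε₁)) from rfl, ← ENNReal.ofReal_mul (by positivity),
            ← ENNReal.ofReal_mul (by positivity)]
          exact ENNReal.ofReal_le_ofReal hrU.le
      _ = (ENNReal.ofReal ((q * ((1 + 3 * r ^ 2)⁻¹) ^ 2) ^ E₁) * vb) * (ENNReal.ofReal ((1 + ε) * ρ₀) * balLebesgue L A) := by ring
      _ ≤ w * (ENNReal.ofReal ((1 + ε) * ρ₀) * balLebesgue L A) := by gcongr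

/-- ★★ **SHARP «PiDensity» in the Euclidean radius**: the same with `A ⊆ {v | ‖linkEmbed L v‖ < r}` (the Euclidean norm of the link space dominates the sup norm). [folklore] -/
theorem orthoTransverse_sharp_linkEmbed :
    ∃ ρ₀ : ℝ, 0 < ρ₀ ∧ ∀ ε : ℝ, 0 < ε → ∃ r : ℝ, 0 < r ∧ ∀ A : Set (Edge 3 L → Fin 3 → ℝ), MeasurableSet A → A ⊆ capBalancedSet L → A ⊆ {v | ‖linkEmbed L v‖ < r} →
      ENNReal.ofReal ((1 - ε) * ρ₀) * balLebesgue L A ≤ orthoTransverse L A ∧ orthoTransverse L A ≤ ENNReal.ofReal ((1 + ε) * ρ₀) * balLebesgue L A := by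
  obtain ⟨ρ₀, hρ₀, h⟩ := orthoTransverse_sharp L
  refine ⟨ρ₀, hρ₀, fun ε hε => ?_⟩
  obtain ⟨r, hr, h⟩ := h ε hε
  refine ⟨r, hr, fun A hA hAc hAb => h A hA hAc fun v hv => ?_⟩
  rw [mem_ball_zero_iff, pi_norm_lt_iff hr]
  intro e
  exact (norm_apply_le_norm_linkEmbed v e).trans_lt (hAb hv)

/-- ★★ **SHARP «PiDensity», MEASURE FORM**: with `S = capBalancedSet L ∩ ball 0 r`, `(1−ε)ρ₀·ν|_S ≤ π|_S ≤ (1+ε)ρ₀·ν|_S` as measures (`ν = balLebesgue L`, `π = orthoTransverse L`). [folklore] -/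
theorem orthoTransverse_restrict_sharp :
    ∃ ρ₀ : ℝ, 0 < ρ₀ ∧ ∀ ε : ℝ, 0 < ε → ∃ r : ℝ, 0 < r ∧
      ENNReal.ofReal ((1 - ε) * ρ₀) • (balLebesgue L).restrict (capBalancedSet L ∩ Metric.ball 0 r) ≤ (orthoTransverse L).restrict (capBalancedSet L ∩ Metric.ball 0 r) ∧
      (orthoTransverse L).restrict (capBalancedSet L ∩ Metric.ball 0 r) ≤ ENNReal.ofReal ((1 + ε) * ρ₀) • (balLebesgue L).restrict (capBalancedSet L ∩ Metric.ball 0 r) := by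
  obtain ⟨ρ₀, hρ₀, h⟩ := orthoTransverse_sharp L
  refine ⟨ρ₀, hρ₀, fun ε hε => ?_⟩
  obtain ⟨r, hr, h⟩ := h ε hε
  have hSm : MeasurableSet (capBalancedSet L ∩ Metric.ball (0 : Edge 3 L → Fin 3 → ℝ) r) := (measurableSet_capBalancedSet L).inter Metric.isOpen_ball.measurableSet
  refine ⟨r, hr, Measure.le_iff.2 fun A hA => ?_, Measure.le_iff.2 fun A hA => ?_⟩
  · rw [Measure.restrict_apply hA, Measure.smul_apply, Measure.restrict_apply hA, smul_eq_mul]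
    exact (h (A ∩ _) (hA.inter hSm) (Set.inter_subset_right.trans Set.inter_subset_left) (Set.inter_subset_right.trans Set.inter_subset_right)).1
  · rw [Measure.restrict_apply hA, Measure.smul_apply, Measure.restrict_apply hA, smul_eq_mul]
    exact (h (A ∩ _) (hA.inter hSm) (Set.inter_subset_right.trans Set.inter_subset_left) (Set.inter_subset_right.trans Set.inter_subset_right)).2

/-- ★★★ **SHARP «PiDensity», INTEGRAL FORM**: there is `ρ₀ > 0` such that for every `ε > 0` some `r > 0` gives
`(1−ε)ρ₀·∫⁻ f dν ≤ ∫⁻ f dπ ≤ (1+ε)ρ₀·∫⁻ f dν` for every measurable `f : (Edge → ℝ³) → [0,∞]` vanishing off the sup-ball `ball 0 r`. [cite: Luscher1983, §3] -/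
theorem orthoTransverse_lintegral_sharp :
    ∃ ρ₀ : ℝ, 0 < ρ₀ ∧ ∀ ε : ℝ, 0 < ε → ∃ r : ℝ, 0 < r ∧ ∀ f : (Edge 3 L → Fin 3 → ℝ) → ℝ≥0∞, Measurable f → (∀ v, f v ≠ 0 → ‖v‖ < r) →
      ENNReal.ofReal ((1 - ε) * ρ₀) * ∫⁻ v, f v ∂balLebesgue L ≤ ∫⁻ v, f v ∂orthoTransverse L ∧
        ∫⁻ v, f v ∂orthoTransverse L ≤ ENNReal.ofReal ((1 + ε) * ρ₀) * ∫⁻ v, f v ∂balLebesgue L := by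
  obtain ⟨ρ₀, hρ₀, h⟩ := orthoTransverse_restrict_sharp L
  refine ⟨ρ₀, hρ₀, fun ε hε => ?_⟩
  obtain ⟨r₁, hr₁, hlo, hup⟩ := h ε hε
  -- shrink the radius below `1/4` so that balanced + small ⇒ capped
  set r : ℝ := min r₁ (1 / 4) with hr
  have hr0 : 0 < r := lt_min hr₁ (by norm_num)
  have hrr₁ : r ≤ r₁ := min_le_left _ _
  have hr4 : r ≤ 1 / 4 := min_le_right _ _
  set S : Set (Edge 3 L → Fin 3 → ℝ) := capBalancedSet L ∩ Metric.ball 0 r₁ with hS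
  have hSm : MeasurableSet S := (measurableSet_capBalancedSet L).inter Metric.isOpen_ball.measurableSet
  refine ⟨r, hr0, fun f hf hf0 => ?_⟩
  -- `∫ f dπ = ∫_S f dπ` (π is carried by the capped balanced set, `f` by the ball)
  have hπS : ∫⁻ v, f v ∂orthoTransverse L = ∫⁻ v in S, f v ∂orthoTransverse L := by
    have hae : ∀ᵐ v ∂orthoTransverse L, v ∈ capBalancedSet L := by
      rw [ae_iff]; exact orthoTransverse_compl_capBalancedSet L
    rw [hS, ← Measure.restrict_restrict (measurableSet_capBalancedSet L),
      Measure.restrict_eq_self_of_ae_mem (μ := (orthoTransverse L).restrict (Metric.ball 0 r₁)) (ae_restrict_of_ae hae)]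
    exact (setLIntegral_eq_of_support_subset fun v hv => mem_ball_zero_iff.2 ((hf0 v hv).trans_le hrr₁)).symm
  -- `∫ f dν = ∫_S f dν` (ν is carried by the balanced set; balanced + small ⇒ capped)
  have hνS : ∫⁻ v, f v ∂balLebesgue L = ∫⁻ v in S, f v ∂balLebesgue L := by
    have hae : ∀ᵐ v ∂balLebesgue L, v ∈ balancedSet L := by
      rw [ae_iff]; exact balLebesgue_compl_balancedSet L
    have h1 : ∫⁻ v, f v ∂balLebesgue L = ∫⁻ v in balancedSet L, f v ∂balLebesgue L := by rw [Measure.restrict_eq_self_of_ae_mem hae]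
    have h2 : ∫⁻ v in balancedSet L, f v ∂balLebesgue L = ∫⁻ v in balancedSet L, S.indicator f v ∂balLebesgue L := by
      refine setLIntegral_congr_fun (measurableSet_balancedSet L) fun v hv => ?_
      by_cases hfv : f v = 0
      · rw [hfv]; by_cases hvS : v ∈ S
        · rw [Set.indicator_of_mem hvS, hfv]
        · rw [Set.indicator_of_notMem hvS]
      · have hvS : v ∈ S := ⟨mem_capBalancedSet_of_norm_lt L hv ((hf0 v hfv).trans_le hr4), mem_ball_zero_iff.2 ((hf0 v hfv).trans_le hrr₁)⟩
        rw [Set.indicator_of_mem hvS]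
    rw [h1, h2, lintegral_indicator hSm, Measure.restrict_restrict hSm, Set.inter_eq_left.2 (Set.inter_subset_left.trans fun v hv => hv.1)]
  rw [hπS, hνS]
  constructor
  · calc ENNReal.ofReal ((1 - ε) * ρ₀) * ∫⁻ v in S, f v ∂balLebesgue L = ∫⁻ v, f v ∂(ENNReal.ofReal ((1 - ε) * ρ₀) • (balLebesgue L).restrict S) := by
          rw [lintegral_smul_measure, smul_eq_mul]
      _ ≤ ∫⁻ v, f v ∂(orthoTransverse L).restrict S := lintegral_mono' hlo le_rfl
  · calc ∫⁻ v in S, f v ∂orthoTransverse L ≤ ∫⁻ v, f v ∂(ENNReal.ofReal ((1 + ε) * ρ₀) • (balLebesgue L).restrict S) := lintegral_mono' hup le_rfl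
      _ = ENNReal.ofReal ((1 + ε) * ρ₀) * ∫⁻ v in S, f v ∂balLebesgue L := by rw [lintegral_smul_measure, smul_eq_mul]

end Summit.QuantumFields.YangMills.Theorems.FemtoTransferGap.TwoLattice.ConstTube

end
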